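import Literature.NumberTheory.Rogawski1990.CartanRealisation
import Literature.NumberTheory.Rogawski1990.ArchTwistGramEmbedding
import Literature.Analysis.Calculus.SquareRootNearOne
import HarnessLib

/-!
# Lemmas for the occurrence of a regular class from an archimedean match: `⋆`-identities for invariant hermitian forms, and square roots
# near a point of a closed real subalgebra of `M_N(L ⊗ ℝ)` (Rogawski 1990 §3.5; Dieudonné (10.2.5))

Topic `NumberTheory/Rogawski1990`; namespace `Literature.NumberTheory.Rogawski1990`.  THEOREMS ONLY (no definition, no instance,
no notation, no named fact), over ★ `CartanAlgebra` ∕ ★ `CartanInvariant` (`hermStar`, `twistGram`) and ★ `Analysis/Calculus/SquareRootNearOne`.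
The two ingredients of ★ `OccurrenceOfArchMatch` (cell `pub/hodgecm-mathlib`, ENGINE T1, law T1b) that are not about number fields:

* §1 (any commutative ring `R`, involution `σ`, form `H`): `H′_g` is hermitian (`transpose_map_twistGram_of_transpose_map_eq`); transport of the
  invariant form `H·x` by a `⋆`-symmetric `s ∈ Z(x)`: `ᵗ(σs)(Hx)s = H·(x s²)` (`twistGram_mul_eq_of_hermStar_eq_self`); `(x⁻¹)⋆ = (x⋆)⁻¹`;
  `P + P⋆` lies in `Z(γ)^⋆` for `P ∈ Z(γ)`, `γ` unitary (`commute_add_hermStar`, `hermStar_add_hermStar_self`); `σ(det M) = det M` for `M`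
  hermitian.  [Rogawski1990, §3.5 p. 29: `T ≅ {x ∈ L[γ] : x x⋆ = 1}`, the `⋆`-calculus on the Cartan algebra.]
* §2 (`L` a number field): in a CLOSED real subalgebra `A ⊆ M_N(L ⊗ ℝ)` the squares of units fill a neighbourhood of `1`
  (`exists_nhds_one_forall_exists_isUnit_mul_self`: `A` is complete for the `L^∞`-operator norm, whose uniformity is the product one, so ★
  `exists_isOpen_injOn_mul_self` applies and the units are open), hence `X · {a² : a ∈ Aˣ}` is a neighbourhood of any unit `X`
  (`exists_nhds_forall_exists_eq_mul_mul_self`).  [Dieudonne1960, (10.2.5).]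

## References
* [Rogawski1990] J. D. Rogawski, *Automorphic Representations of Unitary Groups in Three Variables*, Ann. of Math. Studies 123 (1990), §3.1
  p. 19, §3.5 p. 29.
* [Dieudonne1960] J. Dieudonné, *Foundations of Modern Analysis* (1960), (10.2.5).
-/

noncomputable section

open NumberField NumberField.InfinitePlace NumberField.mixedEmbedding Filter Topology
open scoped Matrix MatrixGroups Classical

namespace Literature.NumberTheory.Rogawski1990

open Literature.NumberTheory.Automorphic
open Literature.AlgebraicGeometry.ShimuraVarieties (unitaryGroup mem_unitaryGroup_iff)

/-! ## §1 Identities over a commutative ring -/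

section Ring

variable {R : Type*} [CommRing R] {n : Type*} [Fintype n] [DecidableEq n] (σ : R →+* R) (H H' : Matrix n n R)

omit [DecidableEq n] in
/-- `H′_g = ᵗ(σg) H′ g` is `σ`-hermitian when `H′` is and `σ` is an involution. [cite: Rogawski1990, §3.1 p. 19] -/
theorem transpose_map_twistGram_of_transpose_map_eq (hσ : ∀ r, σ (σ r) = r) (hH' : (H'.map σ)ᵀ = H') (g : Matrix n n R) :
    ((twistGram σ H' g).map σ)ᵀ = twistGram σ H' g := by
  have hg : (g.map σ).map σ = g := by
    ext i j
    simp only [Matrix.map_apply, hσ]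
  rw [twistGram_def, Matrix.map_mul, Matrix.map_mul, Matrix.transpose_mul, Matrix.transpose_mul, Matrix.transpose_map, hg,
    Matrix.transpose_transpose, hH']
  simp only [Matrix.mul_assoc]

/-- **Transport of the invariant form `H·x` by a `⋆`-symmetric `s` commuting with `x`**: `ᵗ(σ s)(H x) s = H · (x s²)` (`ᵗ(σs) H = H s⋆ = H s`).
[cite: Rogawski1990, §3.5 p. 29] -/
theorem twistGram_mul_eq_of_hermStar_eq_self (hH : IsUnit H.det) {s x : Matrix n n R} (hs : hermStar σ H s = s) (hsx : Commute s x) :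
    twistGram σ (H * x) s = H * (x * (s * s)) := by
  have h1 : (s.map σ)ᵀ * H = H * s := by
    have h := congrArg (H * ·) hs
    simp only [hermStar_def, ← Matrix.mul_assoc, Matrix.mul_nonsing_inv H hH, Matrix.one_mul] at h
    exact h
  calc twistGram σ (H * x) s = (s.map σ)ᵀ * H * x * s := by rw [twistGram_def, ← Matrix.mul_assoc]
    _ = H * s * x * s := by rw [h1]
    _ = H * (x * s) * s := by rw [Matrix.mul_assoc H s x, hsx.eq]
    _ = H * (x * (s * s)) := by simp only [Matrix.mul_assoc]

/-- `(x⁻¹)⋆ = (x⋆)⁻¹` for `x` invertible. [cite: Rogawski1990, §3.5 p. 29] -/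
theorem hermStar_nonsing_inv (hH : IsUnit H.det) {x : Matrix n n R} (hx : IsUnit x.det) :
    hermStar σ H x⁻¹ = (hermStar σ H x)⁻¹ := by
  symm
  apply Matrix.inv_eq_left_inv
  rw [← hermStar_mul σ H hH, Matrix.mul_nonsing_inv x hx, hermStar_one σ H hH]

/-- A linear combination of powers of `M` commutes with `M`. [cite: Rogawski1990, §3.5 p. 29] -/
theorem commute_sum_smul_pow {ι' : Type*} (s : Finset ι') (c : ι' → R) (e : ι' → ℕ) (M : Matrix n n R) :
    Commute (∑ k ∈ s, c k • M ^ e k) M :=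
  Commute.sum_left _ _ _ fun k _ => ((Commute.refl M).pow_left (e k)).smul_left (c k)

/-- `P + P⋆` commutes with the unitary `γ` when `P` does (`Z(γ)` is `⋆`-stable). [cite: Rogawski1990, §3.5 p. 29] -/
theorem commute_add_hermStar (hH : IsUnit H.det) {γ : GL n R} (hγ : γ ∈ unitaryGroup σ H) {P : Matrix n n R}
    (hP : Commute P (γ : Matrix n n R)) : Commute (P + hermStar σ H P) (γ : Matrix n n R) :=
  hP.add_left (mem_cartanAlgebra_iff.mp (hermStar_mem_cartanAlgebra σ H hH hγ (mem_cartanAlgebra_iff.mpr hP)))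

/-- `P + P⋆` is `⋆`-symmetric (`⋆` is an additive involution). [cite: Rogawski1990, §3.5 p. 29] -/
theorem hermStar_add_hermStar_self (hH : IsUnit H.det) (hσ : ∀ r, σ (σ r) = r) (hHh : (H.map σ)ᵀ = H) (P : Matrix n n R) :
    hermStar σ H (P + hermStar σ H P) = P + hermStar σ H P := by
  rw [hermStar_add, hermStar_hermStar σ H hH hσ hHh, add_comm]

/-- The determinant of a `σ`-hermitian matrix is `σ`-fixed. [cite: Rogawski1990, §3.1 p. 19] -/
theorem map_det_eq_det_of_transpose_map_eq {M : Matrix n n R} (hM : (M.map σ)ᵀ = M) : σ M.det = M.det := by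
  conv_rhs => rw [← hM]
  rw [Matrix.det_transpose, ← RingHom.mapMatrix_apply, ← RingHom.map_det]

end Ring

/-! ## §2 Square roots near a point of a closed real subalgebra of `M_N(L ⊗ ℝ)` -/

section Analytic

variable (L : Type) [Field L] [NumberField L] (N : ℕ)

/-- **Squares fill a neighbourhood of `1` in a closed real subalgebra `A ⊆ M_N(L ⊗ ℝ)`** (finite-dimensional, hence complete for the
`L^∞`-operator norm, whose uniformity is the product one; ★ `exists_isOpen_injOn_mul_self`; the units of `A` are open): there is `S ∈ 𝓝 1` in `A`
all of whose elements are `a·a` with `a ∈ Aˣ`. [cite: Dieudonne1960, (10.2.5)] -/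
theorem exists_nhds_one_forall_exists_isUnit_mul_self (A : Subalgebra ℝ (Matrix (Fin N) (Fin N) (mixedSpace L)))
    (hA : IsClosed (A : Set (Matrix (Fin N) (Fin N) (mixedSpace L)))) :
    ∃ S ∈ 𝓝 (1 : ↥A), ∀ u ∈ S, ∃ a : ↥A, IsUnit a ∧ a * a = u := by
  haveI : CompleteSpace (Matrix (Fin N) (Fin N) (mixedSpace L)) :=
    inferInstanceAs (CompleteSpace (Fin N → Fin N → mixedSpace L))
  have hcs : CompleteSpace ↥A := hA.completeSpace_coe
  letI : NormedRing (Matrix (Fin N) (Fin N) (mixedSpace L)) := Matrix.linftyOpNormedRing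
  letI : NormedAlgebra ℝ (Matrix (Fin N) (Fin N) (mixedSpace L)) := Matrix.linftyOpNormedAlgebra (R := ℝ)
  haveI hcs' : @CompleteSpace ↥A (PseudoMetricSpace.toUniformSpace) := hcs
  obtain ⟨U, -, -, -, hmap⟩ := @Literature.Analysis.Calculus.exists_isOpen_injOn_mul_self ℝ _ ↥A _ _ hcs' two_ne_zero
  have h2 := (@Units.isOpen ↥A _ _).mem_nhds isUnit_one
  have h3 := Filter.image_mem_map (m := fun a : ↥A => a * a) h2
  rw [hmap] at h3
  refine ⟨_, h3, fun u hu => ?_⟩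
  obtain ⟨a, ha, rfl⟩ := hu
  exact ⟨a, ha, rfl⟩

/-- … translated to an invertible `X ∈ A`: some neighbourhood of `X` in `A` consists of elements `X · a·a`, `a ∈ Aˣ`. [cite: Dieudonne1960, (10.2.5)] -/
theorem exists_nhds_forall_exists_eq_mul_mul_self (A : Subalgebra ℝ (Matrix (Fin N) (Fin N) (mixedSpace L)))
    (hA : IsClosed (A : Set (Matrix (Fin N) (Fin N) (mixedSpace L)))) {X Y : ↥A} (hXY : X * Y = 1) (hYX : Y * X = 1) :
    ∃ S ∈ 𝓝 X, ∀ u ∈ S, ∃ a : ↥A, IsUnit a ∧ X * (a * a) = u := by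
  obtain ⟨S, hS, hSq⟩ := exists_nhds_one_forall_exists_isUnit_mul_self L N A hA
  have hc : Continuous fun u : ↥A => Y * u := continuous_const.mul continuous_id
  have hS' : (fun u : ↥A => Y * u) ⁻¹' S ∈ 𝓝 X := hc.continuousAt.preimage_mem_nhds (by rwa [hYX])
  refine ⟨_, hS', fun u hu => ?_⟩
  obtain ⟨a, ha, hau⟩ := hSq _ hu
  exact ⟨a, ha, by rw [hau, ← mul_assoc, hXY, one_mul]⟩

end Analytic

end Literature.NumberTheory.Rogawski1990

end
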